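import Summits.BirchSwinnertonDyer.BirchSwinnertonDyer.Theorems.ByReductionTypeAtTwoTowerCorankBoundOfChiParts
import Literature.NumberTheory.EllipticCurves.KatoTwistedFiniteness
import Literature.NumberTheory.EllipticCurves.CyclotomicZpExtensionLayerTorsionTwoProofs
import Literature.NumberTheory.EllipticCurves.Kato2004.LayerCharacterTwoProofs
import Literature.NumberTheory.EllipticCurves.RohrlichNonvanishingProofs
import Literature.NumberTheory.EllipticCurves.ModularCurve
import Literature.NumberTheory.EllipticCurves.ModularityVersionApProofs
import Literature.NumberTheory.EllipticCurves.Rank1Residual.Predicates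
import Mathlib.RingTheory.RootsOfUnity.Complex
import HarnessLib

/-!
# Route `ByReductionTypeAtTwo` (rung K4), crux `SupersingularRankZeroAtTwo` (item stmt-BirchSwinnertonDyer-19097), line
# `odd_blind_package` v2.13, slot 4a `stub_classicalNF` (h11) — HAND hKR-G «BOUNDED ℤ₂-CORANK OF `Sel_{2^∞}(E/ℚ_n)` ALONG THE
# CYCLOTOMIC ℤ₂-TOWER AT GOOD SUPERSINGULAR 2»: the (hKR) binder of ★★ p823354
# `OddBlindNF.classicalNoFiniteSubmodule_goodSS_two_of_casselsTateLayerPairing_of_corankBounded`, assembled (G4) from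
# Kato 2004 Cor. 14.3 (1) in LAYER FORM (print input, displayed as the leading binder `hKato`), Rohrlich 1984 (tree THEOREM),
# modularity (print input `hmod`), and the LEAD's kernel glue (A)–(D) (`TowerCorank`, p825069 + its χ-part sequel)

HONEST FRAMING (cell `bsd-2adic`, run/shared/lean/pub/bsd-2adic/, seat `bsd-2adic-tower-1` GEN 64 on the pen GEN 40 SUMMON
«HAND hKR-G» @3c9502670702955a; pen BRIEF-hKR @761ce2be; director-bsd (830) «OPTION (a) SPLIT»; HUMAN RULINGS D-0036 / D-0054 /
D-0074): THEOREMS ONLY (no definition, no named fact, no instance, no `sorry`; axioms the standard trio);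
`--supports stmt-BirchSwinnertonDyer-19097` helper. TWO PRINT INPUTS are DISPLAYED as leading binders and are NOT proved here:
(hKato) Kato, Astérisque 295 (2004), Cor. 14.3 (1) with Thm. 14.2 (2), p. 235, for `K = ℚ_n` the `n`-th layer (`n ≥ 1`) of the
cyclotomic `ℤ₂`-extension, `p = 2`, `χ` an EVEN Dirichlet character mod `2^{n+2}` (= a character of `Gal(ℚ_n/ℚ) = (ℤ/2^{n+2})ˣ/{±1}`)
read on `Γ_ℚ` through the mod-`2^{n+2}` cyclotomic character, in the tree's SUBGROUP model (`W.selmerLayer κ n`, action `W.conjH1`,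
Kato's `chiPart`) — the cell's typing seat `-ty` vendors this text as a Literature named fact (G1b); (hmod) modularity with an
integral Manin constant (`nonempty_modularParametrizationData`, the first conjunct of the line's `PublishedInputsAtTwo`; only the
newform `f` of level `N_E` is used). Everything else is kernel: Rohrlich's theorem (`Rohrlich1984_nonvanishing_twists.primePow_of_
isNewformOf`), `2 ∤ N_E` at a good prime (`dvd_conductorNorm_iff_not_hasGoodReductionAtPrime`), the character bookkeeping of
`Gal(ℚ_n/ℚ)` at `p = 2` (`Kato2004.LayerCharacterTwoProofs`, `CyclotomicZpExtensionLayerTorsionTwoProofs`), and the LEAD ss-1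
GEN 24's tower bound from eventually finite faithful `χ`-parts (`TowerCorank.*`). `stub_classicalNF` is NOT closed by this alone;
19097 OPEN; nothing booked; BSD is proved for no curve by any of this. bears_on: K4 (19097).

## Road (BRIEF-hKR §2 / Greenberg LNM 1716 §1 «finite kernels» / Kato p. 235–236 with Rohrlich 1984 §3)

For `E/ℚ` good (supersingular) at `2`, `hmod` gives the newform `f ∈ S₂(Γ₀(N_E))` of `E` and `2 ∤ N_E`; Rohrlich's theorem
(`P = {2}`) leaves a FINITE set of primitive Dirichlet characters of `2`-power conductor with `L(f, χ, 1) = 0`, hence a bound `c₀`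
on their conductors (§2). For every `k` with `2^{k+3} > c₀` the layer `ℚ_{k+1}` carries a FAITHFUL even character `χ_k` mod `2^{k+3}`
(§1: even, PRIMITIVE of conductor `2^{k+3}`, value at the image of a topological generator `γ` a primitive `2^{k+1}`-th root of
unity, trivial on `Gal(ℚ̄/ℚ_{k+1})`), so `L(f, χ_k, 1) ≠ 0` and (hKato) makes the `χ_k`-part of `Sel_{2^∞}(E/ℚ_{k+1})` FINITE (§3).
The `χ_k`-part is the faithful part `ker (1 + conj_{γ^{2^k}})` (LEAD's (D)), and the LEAD's (C) turns «faithful parts finite for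
`k ≥ k₀`» into `∃ B, ∀ n, zpCorank (W.selmerLayer κ n) 2 ≤ B` (§4).

References: [Kato2004Asterisque] Thm. 14.2, Cor. 14.3, Thm. 14.4 (pp. 235–236); [RohrlichInventiones1984] Theorem p. 409, §3;
[GreenbergLNM1716] §1; [Washington1997] §13.1; [Serre1973] II §3.2.
-/

set_option autoImplicit false
-- the Theorems namespace of this sub repeats the summit name by design (D-0017 nested layout)
set_option linter.dupNamespace false

noncomputable section

open scoped Classical
open Field WeierstrassCurve CongruenceSubgroup
  Literature.NumberTheory.EllipticCurves Literature.NumberTheory.EllipticCurves.ModularForms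
  Literature.NumberTheory.EllipticCurves.Rank1Residual Literature.NumberTheory.GaloisRepresentations

namespace Summit.BirchSwinnertonDyer.BirchSwinnertonDyer.Theorems.TowerHaMa

/-! ### §1 Faithful even characters of `Gal(ℚ_n/ℚ)` and their value at a topological generator -/

section Characters

variable {n M : ℕ} [NeZero M]

/-- If an EVEN Dirichlet character `χ` mod `2^{n+2}` takes a primitive `2^n`-th root of unity at `g = 5`, then it takes a
primitive `2^n`-th root of unity at ANY unit `u` such that every unit is `±u^t` (e.g. the image of a topological generator of
the cyclotomic `ℤ₂`-extension): `χ(u)^{2^n} = 1` because `u = ±g^k`, and `χ(g) = χ(u)^t` has order `2^n`.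
[cite: Washington1997, §13.1] -/
theorem isPrimitiveRoot_apply_of_forall_eq_pow_or_eq_neg_pow (hM : M = 2 ^ (n + 2)) {g : (ZMod M)ˣ}
    (hg : (g : ZMod M) = 5) {χ : DirichletCharacter ℂ M} (hχ : χ.Even)
    (hprim : IsPrimitiveRoot (χ (g : ZMod M)) (2 ^ n)) {u : (ZMod M)ˣ}
    (hu : ∀ b : (ZMod M)ˣ, ∃ t : ℕ, b = u ^ t ∨ b = -(u ^ t)) :
    IsPrimitiveRoot (χ (u : ZMod M)) (2 ^ n) := by
  -- `χ(±b^t) = χ(b)^t`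
  have hval : ∀ (b : (ZMod M)ˣ) (t : ℕ) (c : (ZMod M)ˣ), (c = b ^ t ∨ c = -(b ^ t)) →
      χ (c : ZMod M) = χ (b : ZMod M) ^ t := by
    rintro b t c (rfl | rfl)
    · rw [Units.val_pow_eq_pow_val, map_pow]
    · rw [Units.val_neg, hχ.eval_neg, Units.val_pow_eq_pow_val, map_pow]
  -- `(χ u)^{2^n} = 1` since `u = ± g^k`
  obtain ⟨k, -, hk⟩ := Kato2004.LayerCharacterTwo.exists_eq_five_pow_or_eq_neg_five_pow hM hg u
  have hu1 : χ (u : ZMod M) ^ 2 ^ n = 1 := by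
    rw [hval g k u hk, ← pow_mul, mul_comm, pow_mul, hprim.pow_eq_one, one_pow]
  -- `χ g = (χ u)^t`
  obtain ⟨t, ht⟩ := hu g
  have hgt : χ (g : ZMod M) = χ (u : ZMod M) ^ t := hval u t g ht
  have h1 : orderOf (χ (u : ZMod M)) ∣ 2 ^ n := orderOf_dvd_of_pow_eq_one hu1
  have h2 : 2 ^ n ∣ orderOf (χ (u : ZMod M)) := by
    rw [hprim.eq_orderOf, hgt]
    exact orderOf_pow_dvd t
  rw [← Nat.dvd_antisymm h1 h2]
  exact IsPrimitiveRoot.orderOf _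

/-- **Faithful even characters of the layer `ℚ_n` (`n ≥ 1`) of a cyclotomic `ℤ₂`-extension `κ` of `ℚ`.** For `M = 2^{n+2}` and a
topological generator `γ` of `κ` there is a Dirichlet character `χ` mod `M` over `ℂ` which is EVEN (a character of
`Gal(ℚ_n/ℚ) = (ℤ/M)ˣ/{±1}`), PRIMITIVE (conductor `M`), takes a PRIMITIVE `2^n`-th root of unity at `χ_cyc^{(M)}(γ)` (faithful on
`Gal(ℚ_n/ℚ) = ⟨γ⟩`), and kills `χ_cyc^{(M)}(Gal(ℚ̄/ℚ_n))` (= `{±1}`). Assembly of `Kato2004.LayerCharacterTwo.exists_even_apply_five_eq`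
/ `isPrimitive_of_even_of_apply_five` with `IsCyclotomic.exists_eq_pow_or_eq_neg_pow_of_isTopGenerator_two` /
`dirichletCharacter_apply_eq_one_of_mem_layerSubgroup_two`. [cite: Washington1997, §13.1] -/
theorem exists_even_isPrimitive_faithful_two {κ : ZpExtension ℚ 2} (hκ : κ.IsCyclotomic)
    {γ : Field.absoluteGaloisGroup ℚ} (hγ : κ.IsTopGenerator γ) (hn : 1 ≤ n) (hM : M = 2 ^ (n + 2)) :
    ∃ χ : DirichletCharacter ℂ M, χ.Even ∧ χ.IsPrimitive ∧
      IsPrimitiveRoot (χ ((modNCyclotomicCharacter ℚ M γ : (ZMod M)ˣ) : ZMod M)) (2 ^ n) ∧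
      ∀ σ ∈ κ.layerSubgroup n, χ ((modNCyclotomicCharacter ℚ M σ : (ZMod M)ˣ) : ZMod M) = 1 := by
  obtain ⟨g, hg⟩ := Kato2004.LayerCharacterTwo.exists_unit_eq_five (n := n) hM
  have hη := Complex.isPrimitiveRoot_exp (2 ^ n) (pow_ne_zero n two_ne_zero)
  obtain ⟨χ, heven, hχg⟩ := Kato2004.LayerCharacterTwo.exists_even_apply_five_eq hM hg hη
  have hprim : IsPrimitiveRoot (χ (g : ZMod M)) (2 ^ n) := hχg ▸ hη
  exact ⟨χ, heven, Kato2004.LayerCharacterTwo.isPrimitive_of_even_of_apply_five hn hM hg hprim,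
    isPrimitiveRoot_apply_of_forall_eq_pow_or_eq_neg_pow hM hg heven hprim
      (hκ.exists_eq_pow_or_eq_neg_pow_of_isTopGenerator_two hγ n hM),
    fun σ hσ ↦ hκ.dirichletCharacter_apply_eq_one_of_mem_layerSubgroup_two n hM χ heven hσ⟩

end Characters

/-! ### §2 Rohrlich: Kato's non-vanishing hypothesis for ALL primitive characters of large `2`-power conductor -/

section Rohrlich

variable {W : WeierstrassCurve ℚ} [W.IsElliptic] {N : ℕ} [NeZero N] {f : CuspForm (Gamma0 N) 2}

/-- **Beyond Rohrlich's finite exceptional set, Kato's hypothesis holds.** For the newform `f` of `E/ℚ` with `2 ∤ N` there is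
`c₀` such that every PRIMITIVE Dirichlet character `χ` of `2`-power modulus `M > c₀` has `L(f, χ, 1) ≠ 0` in Kato's spelling
(an entire continuation of `twistedLSeries f χ`, which exists by `exists_differentiable_eq_twistedLSeries_holds`, not vanishing at
`1`): the exceptional primitive characters form a finite set (`Rohrlich1984_nonvanishing_twists.primePow_of_isNewformOf`, tree
THEOREM) and `c₀` bounds their conductors. [cite: RohrlichInventiones1984, Theorem (p. 409)] -/
theorem exists_forall_twistedLValue_ne_zero_of_isPrimitive_two (hf : IsNewformOf W f) (h2N : ¬ 2 ∣ N) :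
    ∃ c₀ : ℕ, ∀ (M : ℕ) [NeZero M] (χ : DirichletCharacter ℂ M), M.primeFactors ⊆ {2} → χ.IsPrimitive → c₀ < M →
      ∃ L : ℂ → ℂ, Differentiable ℂ L ∧ (∀ s : ℂ, 2 < s.re → L s = twistedLSeries f χ s) ∧ L 1 ≠ 0 := by
  have hS := Rohrlich1984_nonvanishing_twists.primePow_of_isNewformOf hf h2N
  refine ⟨hS.toFinset.sup Sigma.fst, fun M _ χ hM hχ hlt ↦ ?_⟩
  obtain ⟨L, hLd, hLs⟩ := exists_differentiable_eq_twistedLSeries_holds f χ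
  refine ⟨L, hLd, hLs, fun h1 ↦ ?_⟩
  have hmem : (⟨M, χ⟩ : Σ m : ℕ, DirichletCharacter ℂ m) ∈ hS.toFinset :=
    hS.mem_toFinset.mpr ⟨NeZero.ne M, hM, hχ, L, hLd, hLs, h1⟩
  have hle : M ≤ hS.toFinset.sup Sigma.fst := Finset.le_sup (f := Sigma.fst) hmem
  exact absurd hlt (not_lt.mpr hle)

end Rohrlich

/-! ### §3 Kato + Rohrlich: the faithful `χ`-parts of `Sel_{2^∞}(E/ℚ_{k+1})` are finite for all large `k` -/

section Kato

/-- **Eventually finite faithful `χ`-parts along the cyclotomic `ℤ₂`-tower** (Kato Cor. 14.3 (1) + Rohrlich). Let `E = W/ℚ` be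
elliptic, globally minimal, with GOOD reduction at `2` (here from `GoodSS W 2`), `κ` a cyclotomic `ℤ₂`-extension with topological
generator `γ`. GRANTED (hKato) = Kato Cor. 14.3 (1) in layer form and (hmod) = modularity: there is `k₀` such that for every
`k ≥ k₀` some EVEN Dirichlet character `χ` mod `2^{k+3}` — faithful on `Gal(ℚ_{k+1}/ℚ)` (`χ(χ_cyc(γ))` a primitive `2^{k+1}`-th root
of unity) and trivial on `Gal(ℚ̄/ℚ_{k+1})` — has FINITE `χ`-part `Sel_{2^∞}(E/ℚ_{k+1})^{(χ)}` (Kato's `chiPart` for the action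
`W.conjH1 2 (κ.layerSubgroup (k+1))`, intersected with `W.selmerLayer κ (k+1)`). Road: module docstring (§1 character, §2
Rohrlich with `2 ∤ N_E` from good reduction, then hKato at `L(f, χ, 1) ≠ 0`).
[cite: Kato2004Asterisque, Cor. 14.3 (1), Thm. 14.4 (pp. 235–236)] [cite: RohrlichInventiones1984, Theorem (p. 409), §3] -/
theorem eventually_exists_faithful_finite_chiPart_selmerLayer_two
    (hKato : ∀ (W : WeierstrassCurve ℚ) [W.IsElliptic] {N : ℕ} [NeZero N] {f : CuspForm (Gamma0 N) 2}
      (_hf : IsNewformOf W f) (κ : ZpExtension ℚ 2) (_hκ : κ.IsCyclotomic) (n : ℕ) (_hn : 1 ≤ n)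
      (χ : DirichletCharacter ℂ (2 ^ (n + 2))) (_hχ : χ.Even)
      (_hL : ∃ L : ℂ → ℂ, Differentiable ℂ L ∧
        (∀ s : ℂ, 2 < s.re → L s = twistedLSeries f χ s) ∧ L 1 ≠ 0),
      Finite ↥(chiPart (fun σ : Field.absoluteGaloisGroup ℚ => W.conjH1 2 (κ.layerSubgroup n) σ)
          (fun σ => (χ ((modNCyclotomicCharacter ℚ (2 ^ (n + 2)) σ : (ZMod (2 ^ (n + 2)))ˣ) :
            ZMod (2 ^ (n + 2))) : ℂ)) ⊓
        W.selmerLayer κ n))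
    (hmod : nonempty_modularParametrizationData)
    (W : WeierstrassCurve ℚ) [W.IsElliptic] [W.IsGloballyMinimal] (hss : GoodSS W 2)
    (κ : ZpExtension ℚ 2) (hκ : κ.IsCyclotomic) {γ : Field.absoluteGaloisGroup ℚ} (hγ : κ.IsTopGenerator γ) :
    ∃ k₀ : ℕ, ∀ k : ℕ, k₀ ≤ k → ∃ χ : DirichletCharacter ℂ (2 ^ (k + 1 + 2)), χ.Even ∧
      IsPrimitiveRoot (χ ((modNCyclotomicCharacter ℚ (2 ^ (k + 1 + 2)) γ : (ZMod (2 ^ (k + 1 + 2)))ˣ) :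
        ZMod (2 ^ (k + 1 + 2)))) (2 ^ (k + 1)) ∧
      (∀ σ ∈ κ.layerSubgroup (k + 1),
        χ ((modNCyclotomicCharacter ℚ (2 ^ (k + 1 + 2)) σ : (ZMod (2 ^ (k + 1 + 2)))ˣ) : ZMod (2 ^ (k + 1 + 2))) = 1) ∧
      Finite ↥(chiPart (fun σ : Field.absoluteGaloisGroup ℚ => W.conjH1 2 (κ.layerSubgroup (k + 1)) σ)
          (fun σ => (χ ((modNCyclotomicCharacter ℚ (2 ^ (k + 1 + 2)) σ : (ZMod (2 ^ (k + 1 + 2)))ˣ) :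
            ZMod (2 ^ (k + 1 + 2))) : ℂ)) ⊓
        W.selmerLayer κ (k + 1)) := by
  -- the newform of `W` (modularity) and `2 ∤ N_E` (good reduction at `2`)
  haveI : NeZero (W.conductorNorm ℤ) := ⟨(W.conductorNorm_pos_holds).ne'⟩
  obtain ⟨Dm⟩ := hmod W
  have hf : IsNewformOf W Dm.f := Dm.isNewformOf
  have h2N : ¬ 2 ∣ W.conductorNorm ℤ := fun h ↦
    (W.dvd_conductorNorm_iff_not_hasGoodReductionAtPrime 2).mp h hss.1
  -- Rohrlich's bound on the exceptional conductors
  obtain ⟨c₀, hc₀⟩ := exists_forall_twistedLValue_ne_zero_of_isPrimitive_two hf h2N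
  refine ⟨c₀, fun k hk ↦ ?_⟩
  obtain ⟨χ, heven, hprimχ, hroot, hker⟩ :=
    exists_even_isPrimitive_faithful_two (n := k + 1) (M := 2 ^ (k + 1 + 2)) hκ hγ (Nat.succ_pos k) rfl
  have h2pf : (2 ^ (k + 1 + 2)).primeFactors ⊆ {2} := by
    rw [Nat.primeFactors_prime_pow (by omega) Nat.prime_two]
  have hlt : c₀ < 2 ^ (k + 1 + 2) :=
    lt_of_le_of_lt hk (lt_trans (by omega : k < k + 1 + 2) (Nat.lt_two_pow_self))
  have hL := hc₀ (2 ^ (k + 1 + 2)) χ h2pf hprimχ hlt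
  exact ⟨χ, heven, hroot, hker, hKato W hf κ hκ (k + 1) (by omega) χ heven hL⟩

end Kato

/-! ### §4 ★★ G4 — THE (hKR) BINDER OF p823354: bounded `ℤ₂`-corank of `Sel_{2^∞}(E/ℚ_n)` along the cyclotomic `ℤ₂`-tower at
good supersingular `2`, modulo (hKato) and (hmod) -/

section Assembly

/-- ★★ **HAND hKR-G: `corank_{ℤ₂} Sel_{2^∞}(E/ℚ_n)` IS BOUNDED ALONG THE CYCLOTOMIC `ℤ₂`-TOWER for `E/ℚ` good supersingular at
`2`, GRANTED Kato's Cor. 14.3 (1) in layer form (hKato) and modularity (hmod).** Conclusion = the binder (hKR) of ★★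
`OddBlindNF.classicalNoFiniteSubmodule_goodSS_two_of_casselsTateLayerPairing_of_corankBounded` (p823354 :123–124) VERBATIM:
for every globally minimal elliptic `W/ℚ` with `GoodSS W 2` and every CYCLOTOMIC `ℤ₂`-extension `κ`,
`∃ B, ∀ n, zpCorank (W.selmerLayer κ n) 2 ≤ B`. Proof: pick a topological generator `γ` (`κ` is onto `ℤ₂`); by
`eventually_exists_faithful_finite_chiPart_selmerLayer_two` (Rohrlich + hKato) the faithful `χ_k`-part of `Sel_{2^∞}(E/ℚ_{k+1})` is
finite for all `k ≥ k₀`, with `χ_k` multiplicative on `Γ_ℚ`, trivial on `Gal(ℚ̄/ℚ_{k+1})`, `χ_k(γ)` a primitive `2^{k+1}`-th root of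
unity; the LEAD's socket `TowerCorank.exists_forall_zpCorank_selmerLayer_le_of_eventually_finite_chiPart` (p825270: faithful
`χ`-part = `ker (1 + conj_{γ^{2^k}})`; p825069: one-step corank bound by res/cor, telescoped) gives the bound. NO control theorem
at the supersingular prime is used; only good reduction at `2` enters (`2 ∤ N_E` for Rohrlich). What this is NOT: not a theorem
without (hKato) (Kato's Euler-system argument is not in the tree), not the finiteness of `Ш(E/ℚ_n)[2^∞]`, not Greenberg's Thm. 1.9,
not slot 4 / `stub_classicalNF` closed (that needs (hCT) too), not BSD for any curve.
[cite: Kato2004Asterisque, Cor. 14.3 (1), Thm. 14.4 (pp. 235–236)] [cite: RohrlichInventiones1984, Theorem (p. 409), §3]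
[cite: GreenbergLNM1716, §1] -/
theorem selmerCorank_cyclotomicLayers_bounded_of_goodSS_two
    (hKato : ∀ (W : WeierstrassCurve ℚ) [W.IsElliptic] {N : ℕ} [NeZero N] {f : CuspForm (Gamma0 N) 2}
      (_hf : IsNewformOf W f) (κ : ZpExtension ℚ 2) (_hκ : κ.IsCyclotomic) (n : ℕ) (_hn : 1 ≤ n)
      (χ : DirichletCharacter ℂ (2 ^ (n + 2))) (_hχ : χ.Even)
      (_hL : ∃ L : ℂ → ℂ, Differentiable ℂ L ∧
        (∀ s : ℂ, 2 < s.re → L s = twistedLSeries f χ s) ∧ L 1 ≠ 0),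
      Finite ↥(chiPart (fun σ : Field.absoluteGaloisGroup ℚ => W.conjH1 2 (κ.layerSubgroup n) σ)
          (fun σ => (χ ((modNCyclotomicCharacter ℚ (2 ^ (n + 2)) σ : (ZMod (2 ^ (n + 2)))ˣ) :
            ZMod (2 ^ (n + 2))) : ℂ)) ⊓
        W.selmerLayer κ n))
    (hmod : nonempty_modularParametrizationData) :
    ∀ (W : WeierstrassCurve ℚ) [W.IsElliptic] [W.IsGloballyMinimal], GoodSS W 2 →
      ∀ (κ : ZpExtension ℚ 2), κ.IsCyclotomic → ∃ B : ℕ, ∀ n : ℕ, zpCorank (W.selmerLayer κ n) 2 ≤ B := by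
  intro W _ _ hss κ hκ
  -- a topological generator of `κ` (`κ : Γ_ℚ → ℤ₂` is onto)
  obtain ⟨γ, hγ⟩ := κ.surjective (Multiplicative.ofAdd 1)
  have hγ' : κ.IsTopGenerator γ := hγ
  obtain ⟨k₀, hk₀⟩ := eventually_exists_faithful_finite_chiPart_selmerLayer_two hKato hmod W hss κ hκ hγ'
  refine TowerCorank.exists_forall_zpCorank_selmerLayer_le_of_eventually_finite_chiPart (R := ℂ) W 2 κ hγ'
    ⟨k₀, fun k hk ↦ ?_⟩
  obtain ⟨χ, _heven, hroot, hker, hfin⟩ := hk₀ k hk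
  exact ⟨fun σ ↦ (χ ((modNCyclotomicCharacter ℚ (2 ^ (k + 1 + 2)) σ : (ZMod (2 ^ (k + 1 + 2)))ˣ) :
      ZMod (2 ^ (k + 1 + 2))) : ℂ),
    fun σ τ ↦ by dsimp only; rw [map_mul, Units.val_mul, map_mul], hker, hroot, hfin⟩

end Assembly

end Summit.BirchSwinnertonDyer.BirchSwinnertonDyer.Theorems.TowerHaMa

end
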